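import Literature.NumberTheory.Rogawski1990.CMLocalAPacketMembers                                 -- ★ `qsForm`, `Gqs` (the quasi-split `U(Φ₃)(L⁺_v)`)
import Literature.NumberTheory.Automorphic.LocalUnitaryGroupSimilitude                              -- ★ `cmDatumLocalCongr`, `formCongr_inv_formCongr`, `local_eq_unitaryGroupOfForm_map`
import Literature.NumberTheory.Automorphic.UnitaryConjClassClosed                                   -- ★ `map_transpose_formCongr`
import Literature.NumberTheory.Automorphic.IrreducibleClassesComapInner                             -- ★ `IrrClass.comap_eq_comap_of_forall_eq_conj` (inner automorphisms fix classes)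
import Literature.NumberTheory.Automorphic.UnitaryGroupFrameSubform                                 -- ★ `det_formCongr`
import Literature.NumberTheory.Automorphic.UnitaryGroupFormCongrFinSum                              -- ★ `formCongr_mul_eq`, `formCongr_smul_eq`
import HarnessLib

/-!
# R90-TF · S7 (Ch. 14.6-tuple, C146) · S7-J2★ «O2 JUNCTION», PART 1∕3 — a SELF-similitude of `Φ₃` acts on `Irr(U(Φ₃)(L⁺_v))` as an INNER automorphism
# ([Rogawski1990, §14.2 p. 234 «the equivalence classes of representations … are canonically identified»; §1.9 p. 8], [PlatonovRapinchuk1994, §2.3])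

Cell `hodgecm-mathlib`, crux H413 (`stmt-HodgeConjecture-24833`), route of record `HCCMUnconditional`; programme R90-TF (brief `director/R90-BRIEF.v2.md`
1f40d54518340a35), section S7 = Rogawski §14.6 (base `R90-C146`), seat R90-C146-p01 (g0); deal S7-R8∕S7-J2★ (LH7-plan (g4)) under RULINGS S7-R9 (B), S7-R11 (b), S7-R12,
S7-R14 (F2).  Helper file 1∕3 of the junction `Theorems/R90S7RigidCoreOfQsRigidity.lean` (`pkRigidCore_of_qsRigidCore : (∀ L, QsRigidCore L) → F0U3LettersRung1.PKrigidCoreLetter`),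
lane `--supports stmt-HodgeConjecture-24833 --as helper`; LEAF-FREE, KIT-FREE; theorems only (no `def`, no instance, no notation, no `sorry`).

CONTENT (local algebra on `U(Φ₃)(L⁺_v)`, `Φ₃ = antidiag(1,1,1)`, `σ = c ⊗ 1` on `L ⊗ L⁺_v`).  For a SELF-similitude `ᵗ(σT) · Φ₃ · T = a · Φ₃` (`a` a unit): `σ a = a` (both sides
hermitian), `σ(det T) · det T = a³` (determinants), hence — ODD RANK — `a = σ z · z` for the unit `z := det T ∕ a` (`exists_norm_eq_of_formCongr_qsForm`); so `U := z⁻¹ T`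
lies in `U(Φ₃)(L⁺_v)` and `Ad(T) = Ad(U)` (`exists_unitary_conj_eq_of_formCongr_qsForm`): conjugation by a self-similitude is INNER, and two identifications of a group
with `U(Φ₃)_v` that differ by a self-similitude induce the SAME map on `Irr` (`comap_eq_comap_of_conj_formCongr_qsForm`, ★ `IrrClass.comap_eq_comap_of_forall_eq_conj`).
Plus the inverse-similitude bookkeeping `formCongr_inv_eq_smul_of_formCongr_eq_smul`.  Consumers: parts 2∕3 (`R90S7ConjugatorSimilitude`, `R90S7RigidCoreTransport`).

HONEST LABEL: local algebra closes no citation.  HC_CM is proved only modulo the 7 printed citations (2 remaining named inputs: hLiu418 = stmt-HodgeConjecture-24832,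
h413 = stmt-HodgeConjecture-24833) — until rung 0 closes.

## References
* [Rogawski1990] J. D. Rogawski, *Automorphic Representations of Unitary Groups in Three Variables*, Ann. of Math. Stud. 123 (1990): §1.9 p. 8; §14.2 pp. 232–234.
* [PlatonovRapinchuk1994] V. Platonov, A. Rapinchuk, *Algebraic Groups and Number Theory* (1994), §2.3.
* [BushnellHenniart2006] C. J. Bushnell, G. Henniart, *The Local Langlands Conjecture for GL(2)*, Grundlehren 335 (2006), §1.1.
-/

set_option autoImplicit false
-- the mandated namespace repeats the single-problem summit's segment (`HodgeConjecture.HodgeConjecture`)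
set_option linter.dupNamespace false

noncomputable section

open NumberField IsDedekindDomain
open scoped Matrix MatrixGroups

namespace Summit.HodgeConjecture.HodgeConjecture.R90.S7

open Literature.NumberTheory Literature.NumberTheory.Automorphic Literature.NumberTheory.Automorphic.UnitaryGroup
open Literature.NumberTheory.Rogawski1990

/-! ## §1 Local algebra on `U(Φ₃)(L⁺_v)`: a SELF-similitude of `Φ₃` acts on `Irr` as an inner automorphism -/

section LocalAlgebra

variable (L : Type) [Field L] [NumberField L] [IsCMField L] (v : HeightOneSpectrum (𝓞 ↥(maximalRealSubfield L)))

/-- `Φ₃ ⊗ 1 ∈ M₃(L ⊗ L⁺_v)` is hermitian for `c ⊗ 1` (entries `0, 1`, symmetric pattern). [cite: Rogawski1990, §1.9 p. 8] -/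
theorem map_conjLocal_transpose_qsForm :
    (((qsForm L).map (algebraMap L (LocalRing L v))).map (conjLocal L (IsCMField.complexConj L) v))ᵀ =
      (qsForm L).map (algebraMap L (LocalRing L v)) := by
  refine Matrix.ext fun i j => ?_
  simp only [Matrix.transpose_apply, Matrix.map_apply, Matrix.of_apply]
  by_cases hij : i.val + j.val + 1 = 3
  · have hji : j.val + i.val + 1 = 3 := by omega
    rw [if_pos hji, if_pos hij, conjLocal_algebraMap, map_one]
  · have hji : ¬ (j.val + i.val + 1 = 3) := by omega
    rw [if_neg hji, if_neg hij, conjLocal_algebraMap, map_zero]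

/-- **The multiplier of a self-similitude of `Φ₃` is `(c ⊗ 1)`-fixed**: `ᵗT̄ · Φ₃ · T = a • Φ₃ ⇒ ā = a` (both sides are hermitian, ★
`map_transpose_formCongr`; read off the `(0,2)` entry). [cite: Rogawski1990, §1.9 p. 8] [cite: PlatonovRapinchuk1994, §2.3] -/
theorem conjLocal_eq_self_of_formCongr_qsForm (T : GL (Fin 3) (LocalRing L v)) {a : LocalRing L v}
    (h : formCongr (conjLocal L (IsCMField.complexConj L) v) T ((qsForm L).map (algebraMap L (LocalRing L v))) =
      a • (qsForm L).map (algebraMap L (LocalRing L v))) :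
    conjLocal L (IsCMField.complexConj L) v a = a := by
  have hh := map_transpose_formCongr (conjLocal L (IsCMField.complexConj L) v) _ (map_conjLocal_transpose_qsForm L v)
    (conjLocal_conjLocal_cm L v) T
  rw [h, Matrix.map_smul', Matrix.transpose_smul, map_conjLocal_transpose_qsForm] at hh
  · have h02 := congrFun (congrFun hh 0) 2
    simp only [Matrix.smul_apply, Matrix.map_apply, Matrix.of_apply, smul_eq_mul] at h02
    simpa using h02
  · exact fun x y => map_mul _ x y

omit [IsCMField L] in
/-- `det (Φ₃ ⊗ 1)` is a unit. [cite: Rogawski1990, §1.9 p. 8] -/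
theorem isUnit_det_qsForm_map : IsUnit ((qsForm L).map (algebraMap L (LocalRing L v))).det := by
  rw [← RingHom.mapMatrix_apply, ← RingHom.map_det]
  exact (isUnit_antidiagOne_det L 3).map _

/-- **Determinants of a self-similitude**: `ᵗT̄ · Φ₃ · T = a • Φ₃ ⇒ σ(det T) · det T = a³` (★ `det_formCongr`; `det Φ₃` is a unit). [cite: PlatonovRapinchuk1994, §2.3] -/
theorem conjLocal_det_mul_det_eq_of_formCongr_qsForm (T : GL (Fin 3) (LocalRing L v)) {a : LocalRing L v}
    (h : formCongr (conjLocal L (IsCMField.complexConj L) v) T ((qsForm L).map (algebraMap L (LocalRing L v))) =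
      a • (qsForm L).map (algebraMap L (LocalRing L v))) :
    conjLocal L (IsCMField.complexConj L) v (T : Matrix (Fin 3) (Fin 3) (LocalRing L v)).det *
      (T : Matrix (Fin 3) (Fin 3) (LocalRing L v)).det = a ^ 3 := by
  have h1 := congrArg Matrix.det h
  rw [det_formCongr, Matrix.det_smul, Fintype.card_fin] at h1
  refine (isUnit_det_qsForm_map L v).mul_right_cancel ?_
  rw [← h1]
  ring

/-- **A SELF-SIMILITUDE OF `Φ₃` HAS A NORM AS MULTIPLIER** (odd rank): `ᵗT̄ · Φ₃ · T = a • Φ₃`, `a` a unit ⇒ `a = z̄ z` for the unit `z := det T ∕ a`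
(`N(det T) = a³`, `ā = a`). [cite: PlatonovRapinchuk1994, §2.3] [cite: Rogawski1990, §1.9 p. 8] -/
theorem exists_norm_eq_of_formCongr_qsForm (T : GL (Fin 3) (LocalRing L v)) {a : LocalRing L v} (ha : IsUnit a)
    (h : formCongr (conjLocal L (IsCMField.complexConj L) v) T ((qsForm L).map (algebraMap L (LocalRing L v))) =
      a • (qsForm L).map (algebraMap L (LocalRing L v))) :
    ∃ z : (LocalRing L v)ˣ, conjLocal L (IsCMField.complexConj L) v (z : LocalRing L v) * z = a := by
  have hσa : conjLocal L (IsCMField.complexConj L) v a = a := conjLocal_eq_self_of_formCongr_qsForm L v T h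
  have hdet := conjLocal_det_mul_det_eq_of_formCongr_qsForm L v T h
  obtain ⟨dT, hdT⟩ : ∃ dT : (LocalRing L v)ˣ, (dT : LocalRing L v) = (T : Matrix (Fin 3) (Fin 3) (LocalRing L v)).det :=
    ⟨(Matrix.isUnits_det_units T).unit, (Matrix.isUnits_det_units T).unit_spec⟩
  obtain ⟨au, hau⟩ : ∃ au : (LocalRing L v)ˣ, (au : LocalRing L v) = a := ⟨ha.unit, ha.unit_spec⟩
  -- `σ` fixes `a`, hence `a⁻¹`
  have hσau : Units.map (conjLocal L (IsCMField.complexConj L) v : LocalRing L v →* LocalRing L v) au = au :=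
    Units.ext (by rw [Units.coe_map, MonoidHom.coe_coe, hau, hσa])
  have hσainv : conjLocal L (IsCMField.complexConj L) v (↑au⁻¹ : LocalRing L v) = ↑au⁻¹ := by
    rw [← MonoidHom.coe_coe, ← Units.coe_map_inv, hσau]
  refine ⟨dT * au⁻¹, ?_⟩
  rw [Units.val_mul, map_mul, hσainv, hdT]
  calc conjLocal L (IsCMField.complexConj L) v (T : Matrix (Fin 3) (Fin 3) (LocalRing L v)).det * ↑au⁻¹ *
        ((T : Matrix (Fin 3) (Fin 3) (LocalRing L v)).det * ↑au⁻¹)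
      = conjLocal L (IsCMField.complexConj L) v (T : Matrix (Fin 3) (Fin 3) (LocalRing L v)).det *
          (T : Matrix (Fin 3) (Fin 3) (LocalRing L v)).det * (↑au⁻¹ * ↑au⁻¹) := by ring
    _ = ((au ^ 3 * (au⁻¹ * au⁻¹) : (LocalRing L v)ˣ) : LocalRing L v) := by rw [hdet, ← hau]; push_cast; ring
    _ = a := by rw [← hau]; congr 1; group

omit [IsCMField L] in
/-- The central unit `z • 1 ∈ GL₃(L ⊗ L⁺_v)`: its matrix is `z • 1` and it commutes with every element (scalars are central). [cite: PlatonovRapinchuk1994, §2.3] -/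
theorem exists_scalarGL_three (z : (LocalRing L v)ˣ) :
    ∃ s : GL (Fin 3) (LocalRing L v), s.val = (z : LocalRing L v) • (1 : Matrix (Fin 3) (Fin 3) (LocalRing L v)) ∧
      ∀ g : GL (Fin 3) (LocalRing L v), s * g = g * s := by
  have hsv : (Units.map (Matrix.scalar (Fin 3) : LocalRing L v →+* Matrix (Fin 3) (Fin 3) (LocalRing L v)).toMonoidHom z).val =
      (z : LocalRing L v) • (1 : Matrix (Fin 3) (Fin 3) (LocalRing L v)) := by
    rw [Units.coe_map, RingHom.toMonoidHom_eq_coe, MonoidHom.coe_coe, Matrix.scalar_apply, Matrix.smul_one_eq_diagonal]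
  refine ⟨Units.map (Matrix.scalar (Fin 3) : LocalRing L v →+* Matrix (Fin 3) (Fin 3) (LocalRing L v)).toMonoidHom z, hsv, fun g => ?_⟩
  refine Units.ext ?_
  rw [Units.val_mul, Units.val_mul, hsv, Matrix.smul_mul, Matrix.mul_smul, Matrix.one_mul, Matrix.mul_one]

/-- **A SELF-SIMILITUDE OF `Φ₃` IS A SCALAR TIMES A UNITARY ELEMENT**: if `ᵗT̄ · Φ₃ · T = a • Φ₃` with `a` a unit, then `Ad(T) = Ad(U)` on `GL₃(L ⊗ L⁺_v)` for some
`U ∈ U(Φ₃)(L⁺_v)` (`U := z⁻¹ T` with `z̄ z = a`; scalars are central) — conjugation by a self-similitude is INNER on `U(Φ₃)(L⁺_v)`.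
[cite: PlatonovRapinchuk1994, §2.3] [cite: Rogawski1990, §1.9 p. 8; §14.2 p. 234] -/
theorem exists_unitary_conj_eq_of_formCongr_qsForm (T : GL (Fin 3) (LocalRing L v)) {a : LocalRing L v} (ha : IsUnit a)
    (h : formCongr (conjLocal L (IsCMField.complexConj L) v) T ((qsForm L).map (algebraMap L (LocalRing L v))) =
      a • (qsForm L).map (algebraMap L (LocalRing L v))) :
    ∃ U : Gqs L v, ∀ g : GL (Fin 3) (LocalRing L v), T * g * T⁻¹ = U.val * g * U.val⁻¹ := by
  obtain ⟨z, hNz⟩ := exists_norm_eq_of_formCongr_qsForm L v T ha h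
  -- the central unit `s := z⁻¹ • 1`
  obtain ⟨s, hsv, hscomm⟩ := exists_scalarGL_three L v z⁻¹
  -- `U := s T` is unitary: `ᵗ(s̄T̄) Φ₃ (sT) = (z̄⁻¹ z⁻¹ a) • Φ₃ = Φ₃`
  have hms : (((↑z⁻¹ : LocalRing L v) • (T : Matrix (Fin 3) (Fin 3) (LocalRing L v))).map (conjLocal L (IsCMField.complexConj L) v)) =
      conjLocal L (IsCMField.complexConj L) v (↑z⁻¹ : LocalRing L v) • (T : Matrix (Fin 3) (Fin 3) (LocalRing L v)).map (conjLocal L (IsCMField.complexConj L) v) :=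
    Matrix.map_smul' _ _ _ (fun x y => map_mul _ x y)
  have hzz : conjLocal L (IsCMField.complexConj L) v (↑z⁻¹ : LocalRing L v) * ↑z⁻¹ * a = 1 := by
    have hσzinv : conjLocal L (IsCMField.complexConj L) v (↑z⁻¹ : LocalRing L v) * conjLocal L (IsCMField.complexConj L) v (z : LocalRing L v) = 1 := by
      rw [← map_mul, Units.inv_mul, map_one]
    calc conjLocal L (IsCMField.complexConj L) v (↑z⁻¹ : LocalRing L v) * ↑z⁻¹ * a
        = conjLocal L (IsCMField.complexConj L) v (↑z⁻¹ : LocalRing L v) * ↑z⁻¹ * (conjLocal L (IsCMField.complexConj L) v (z : LocalRing L v) * z) := by rw [hNz]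
      _ = (conjLocal L (IsCMField.complexConj L) v (↑z⁻¹ : LocalRing L v) * conjLocal L (IsCMField.complexConj L) v (z : LocalRing L v)) * (↑z⁻¹ * z) := by ring
      _ = 1 := by rw [hσzinv, Units.inv_mul, one_mul]
  have h' : ((T : Matrix (Fin 3) (Fin 3) (LocalRing L v)).map (conjLocal L (IsCMField.complexConj L) v))ᵀ *
      (qsForm L).map (algebraMap L (LocalRing L v)) * (T : Matrix (Fin 3) (Fin 3) (LocalRing L v)) = a • (qsForm L).map (algebraMap L (LocalRing L v)) := h
  have hmem : s * T ∈ «local» L (IsCMField.complexConj L) 3 (qsForm L) v := by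
    rw [local_eq_unitaryGroupOfForm_map, mem_unitaryGroupOfForm_iff, Units.val_mul, hsv, Matrix.smul_mul, Matrix.one_mul, hms,
      Matrix.transpose_smul, Matrix.smul_mul, Matrix.smul_mul, Matrix.mul_smul, smul_smul, h', smul_smul, hzz, one_smul]
  refine ⟨⟨s * T, hmem⟩, fun g => ?_⟩
  show T * g * T⁻¹ = s * T * g * (s * T)⁻¹
  rw [mul_inv_rev, show s * T * g * (T⁻¹ * s⁻¹) = s * (T * g * T⁻¹) * s⁻¹ by group, hscomm, mul_inv_cancel_right]

variable {L v}

/-- **TWO IDENTIFICATIONS THAT DIFFER BY A SELF-SIMILITUDE OF `Φ₃` INDUCE THE SAME MAP ON `Irr`**: if `f₂ g′ = S · f₁ g′ · S⁻¹` on matrices for a self-similitude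
`ᵗS̄ · Φ₃ · S = b • Φ₃` (`b` a unit), then `comap f₁ = comap f₂` on `Irr(U(Φ₃)(L⁺_v))` (self-similitudes are inner, `exists_unitary_conj_eq_of_formCongr_qsForm`; inner
automorphisms fix classes, ★ `IrrClass.comap_eq_comap_of_forall_eq_conj`). «The equivalence classes of representations … are canonically identified.»
[cite: Rogawski1990, §14.2 p. 234] [cite: BushnellHenniart2006, §1.1] -/
theorem comap_eq_comap_of_conj_formCongr_qsForm {G' : Type} [Group G'] [TopologicalSpace G'] (f₁ f₂ : G' ≃ₜ* Gqs L v)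
    (S : GL (Fin 3) (LocalRing L v)) {b : LocalRing L v} (hb : IsUnit b)
    (hS : formCongr (conjLocal L (IsCMField.complexConj L) v) S ((qsForm L).map (algebraMap L (LocalRing L v))) =
      b • (qsForm L).map (algebraMap L (LocalRing L v)))
    (hf : ∀ g' : G', ((f₂ g').val : GL (Fin 3) (LocalRing L v)) = S * (f₁ g').val * S⁻¹) (c : IrrClass (Gqs L v)) :
    IrrClass.comap f₁ c = IrrClass.comap f₂ c := by
  obtain ⟨U, hU⟩ := exists_unitary_conj_eq_of_formCongr_qsForm L v S hb hS
  refine IrrClass.comap_eq_comap_of_forall_eq_conj f₁ f₂ U (fun g' => Subtype.ext ?_) c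
  rw [hf g', hU]
  rfl

/-- **Inverse of a similitude**: `ᵗT̄ · M · T = c • N` (`c` a unit) ⇒ `ᵗ(T⁻¹)‾ · N · T⁻¹ = c⁻¹ • M` (★ `formCongr_inv_formCongr`). [cite: PlatonovRapinchuk1994, §2.3] -/
theorem formCongr_inv_eq_smul_of_formCongr_eq_smul (T : GL (Fin 3) (LocalRing L v)) {c : LocalRing L v} (hc : IsUnit c)
    (M N : Matrix (Fin 3) (Fin 3) (LocalRing L v))
    (h : formCongr (conjLocal L (IsCMField.complexConj L) v) T M = c • N) :
    formCongr (conjLocal L (IsCMField.complexConj L) v) T⁻¹ N = (↑hc.unit⁻¹ : LocalRing L v) • M := by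
  have h1 := formCongr_inv_formCongr (conjLocal L (IsCMField.complexConj L) v) T M
  rw [h, formCongr_smul_eq] at h1
  calc formCongr (conjLocal L (IsCMField.complexConj L) v) T⁻¹ N
      = ((↑hc.unit⁻¹ : LocalRing L v) * c) • formCongr (conjLocal L (IsCMField.complexConj L) v) T⁻¹ N := by
          rw [IsUnit.val_inv_mul, one_smul]
    _ = (↑hc.unit⁻¹ : LocalRing L v) • M := by rw [mul_smul, h1]

end LocalAlgebra


end Summit.HodgeConjecture.HodgeConjecture.R90.S7

end
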